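import Summits.RiemannHypothesis.RiemannHypothesis.Theorems.Splittings.BombieriTruncMultiplicitySub
import Literature.Analysis.ODE.ExpPolynomialsLinearIndependent

/-!
# Splittings — x-wuc (xiv-b2, part 2/2): multiplicities — the CLASS-CONSTANT subspace (SZC-free Gram positivity)

Cell rh-split, seat rh-split-x-wuc g5 (brief sha16 f79c5f09d8bcb036), card `run/shared/lean/pub/rh-split/cards/SPLIT-x-wuc.md` §11
(referee rh-split-ref g3 2026-08-27T06:23:10Z: REPLAY PASS of the scratch `HOME/rh-split-x-wuc/SplitXWucG5.lean`; lead RULING #35: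
cut (xiv)).  Carved VERBATIM from that scratch (file of record sha16 66b013c38c58c722); sections as numbered there.
Typer split (rh-split-typer-1 g5, lead RULING #37 «b2 441 l: split or trim to ≤ 400 l at filing»): the cut module (xiv-b2)
`BombieriTruncMultiplicity` (441 l) is filed as TWO modules at the §9/§10 boundary, declarations byte-identical, same namespace.
* THIS PART: §10 `fib`, `classSub`, `avg`, `F_eq_zero_of_fib`, `gram_sub_avg_eq_zero`, `pairing_sub_avg_eq_zero`, `F_eq_zero_of_cost_nonpos`,
  `cost_pos_of_mem_classSub` (Helgason independence over the DISTINCT zeros of `Γ_N`, tree `ExpPolynomialsLinearIndependent`).  UNCONDITIONAL.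
  Part 1/2 (`BombieriTruncMultiplicitySub`): §9 `exists_negRoot_of_screening_sub`.
HONEST LABEL: «SPLITTING SEARCH over kernel-typed RH-EQUIVALENCES; a splitting A ∧ B ⟹ RH is CONDITIONAL bookkeeping
unless A and B are both proved; nothing here bears on the truth of RH.»
-/

set_option linter.dupNamespace false

noncomputable section

open scoped Classical ComplexConjugate
open Set Filter Topology Complex MeasureTheory

namespace Summit.RiemannHypothesis.RiemannHypothesis.Theorems.Splittings.BombieriTruncMultiplicity

open Literature.NumberTheory.LFunctions Literature.NumberTheory.LFunctions.Bombieri2000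
open Summit.RiemannHypothesis.RiemannHypothesis.Theses.RuelleBand
open Summit.RiemannHypothesis.RiemannHypothesis.Theorems.Splittings.BombieriTruncEigen
open Summit.RiemannHypothesis.RiemannHypothesis.Theorems.Splittings.BombieriFozNoDep
open Summit.RiemannHypothesis.RiemannHypothesis.Theorems.Splittings.BombieriTruncGram
open Summit.RiemannHypothesis.RiemannHypothesis.Theorems.Splittings.BombieriTruncPairing
open Summit.RiemannHypothesis.RiemannHypothesis.Theorems.Splittings.BombieriTruncScreening
open Summit.RiemannHypothesis.RiemannHypothesis.Theorems.Splittings.BombieriTruncBandGap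

variable {E : Set ℝ} {N : ℕ}

/-! ## §10 The class-constant subspace of `Γ_N` (zeros with multiplicity)

Slots `(ρ, k)`, `(ρ, k′)` of one multiple zero carry the same exponential. `classSub N` = coefficient vectors
constant on multiplicity classes; `avg` = class averaging (a retraction onto it); vectors with vanishing class
sums synthesise the zero function and pair to zero against class-constant vectors. On `classSub` the Gram form of a
window `[−a, a]` is positive definite WITHOUT any simplicity hypothesis (Helgason over the DISTINCT zeros). -/

/-- The multiplicity class (fibre) of a slot inside `Γ_N`. -/
def fib (j : truncIdx N) : Finset (truncIdx N) :=
  Finset.univ.filter fun i : truncIdx N ↦ (i : ZeroIdx).val = (j : ZeroIdx).val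

/-- `i ∈ fib j` iff the indices `i`, `j` carry the same zero (same multiplicity class). -/
theorem mem_fib {i j : truncIdx N} : i ∈ fib j ↔ (i : ZeroIdx).val = (j : ZeroIdx).val := by
  simp [fib]

/-- Every index lies in its own multiplicity class. -/
theorem self_mem_fib (j : truncIdx N) : j ∈ fib j := mem_fib.2 rfl

/-- Multiplicity classes are nonempty. -/
theorem fib_card_pos (j : truncIdx N) : 0 < (fib j).card := Finset.card_pos.2 ⟨j, self_mem_fib j⟩

/-- Indices carrying the same zero have the same multiplicity class. -/
theorem fib_eq_of_val_eq {i j : truncIdx N} (h : (i : ZeroIdx).val = (j : ZeroIdx).val) : fib i = fib j := by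
  ext k
  rw [mem_fib, mem_fib, h]

/-- Coefficient vectors constant on multiplicity classes. -/
def classSub (N : ℕ) : Submodule ℂ (truncIdx N → ℂ) where
  carrier := {x | ∀ i j : truncIdx N, (i : ZeroIdx).val = (j : ZeroIdx).val → x i = x j}
  add_mem' := by
    intro x y hx hy i j h
    simp only [Pi.add_apply, hx i j h, hy i j h]
  zero_mem' := by
    intro i j _
    rfl
  smul_mem' := by
    intro κ x hx i j h
    simp only [Pi.smul_apply, hx i j h]

/-- Membership in `classSub N`: the coefficient vector is constant on multiplicity classes. -/
theorem mem_classSub {x : truncIdx N → ℂ} :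
    x ∈ classSub N ↔ ∀ i j : truncIdx N, (i : ZeroIdx).val = (j : ZeroIdx).val → x i = x j := Iff.rfl

/-- Class averaging. -/
def avg (w : truncIdx N → ℂ) : truncIdx N → ℂ := fun j ↦ (∑ i ∈ fib j, w i) / (fib j).card

/-- The class average `avg w` is class-constant. -/
theorem avg_mem (w : truncIdx N → ℂ) : avg w ∈ classSub N := by
  intro i j h
  simp only [avg, fib_eq_of_val_eq h]

/-- Fibre sums of `w − avg w` vanish. -/
theorem fib_sum_sub_avg (w : truncIdx N → ℂ) (j : truncIdx N) : ∑ i ∈ fib j, (w - avg w) i = 0 := by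
  have hc : ((fib j).card : ℂ) ≠ 0 := Nat.cast_ne_zero.2 (fib_card_pos j).ne'
  have h1 : ∀ i ∈ fib j, avg w i = (∑ l ∈ fib j, w l) / (fib j).card := by
    intro i hi
    rw [avg, fib_eq_of_val_eq (mem_fib.1 hi)]
  simp only [Pi.sub_apply]
  rw [Finset.sum_sub_distrib, Finset.sum_congr rfl h1, Finset.sum_const, nsmul_eq_mul, mul_div_cancel₀ _ hc,
    sub_self]

/-- A class-constant weight against a vector with vanishing fibre sums gives zero. -/
theorem sum_mul_eq_zero_of_fib {y c : truncIdx N → ℂ} (hy : ∀ j, ∑ i ∈ fib j, y i = 0)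
    (hc : ∀ i j : truncIdx N, (i : ZeroIdx).val = (j : ZeroIdx).val → c i = c j) : ∑ j, y j * c j = 0 := by
  rw [← Finset.sum_fiberwise_of_maps_to (s := Finset.univ)
    (t := Finset.univ.image fun j : truncIdx N ↦ (j : ZeroIdx).val) (g := fun j : truncIdx N ↦ (j : ZeroIdx).val)
    (fun j hj ↦ Finset.mem_image.2 ⟨j, hj, rfl⟩)]
  refine Finset.sum_eq_zero fun ρ hρ ↦ ?_
  obtain ⟨j₀, -, hj₀⟩ := Finset.mem_image.1 hρ
  have hfib : (Finset.univ.filter fun j : truncIdx N ↦ (j : ZeroIdx).val = ρ) = fib j₀ := by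
    ext k
    rw [mem_fib, Finset.mem_filter, hj₀]
    simp
  rw [hfib]
  calc ∑ j ∈ fib j₀, y j * c j = ∑ j ∈ fib j₀, y j * c j₀ :=
        Finset.sum_congr rfl fun j hj ↦ by rw [hc j j₀ (mem_fib.1 hj)]
    _ = (∑ j ∈ fib j₀, y j) * c j₀ := by rw [Finset.sum_mul]
    _ = 0 := by rw [hy j₀, zero_mul]

/-- Vectors with vanishing class sums synthesise the zero function. -/
theorem F_eq_zero_of_fib {y : truncIdx N → ℂ} (hy : ∀ j, ∑ i ∈ fib j, y i = 0) (u : ℝ) : F N y u = 0 := by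
  unfold F
  exact sum_mul_eq_zero_of_fib hy fun i j h ↦ by rw [ZeroIdx.gamma, ZeroIdx.gamma, h]

/-- `tbar` respects multiplicity classes: indices with equal zeros have partners with equal zeros. -/
theorem val_tbar_eq_of_val_eq {i j : truncIdx N} (h : (i : ZeroIdx).val = (j : ZeroIdx).val) :
    ((tbar i : truncIdx N) : ZeroIdx).val = ((tbar j : truncIdx N) : ZeroIdx).val := by
  rw [coe_tbar, coe_tbar, ZeroIdx.val_bar, ZeroIdx.val_bar, h]

/-- … and pair to zero against class-constant vectors. -/
theorem pairing_eq_zero_of_fib {v y : truncIdx N → ℂ} (hv : v ∈ classSub N) (hy : ∀ j, ∑ i ∈ fib j, y i = 0) :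
    pairing N v y = 0 := by
  rw [pairing, Fintype.sum_equiv (tbarEquiv N) _ (fun k ↦ y k * conj (v (tbar k)))
    (fun j ↦ by show _ = y (tbar j) * conj (v (tbar (tbar j))); rw [tbar_tbar, mul_comm])]
  exact sum_mul_eq_zero_of_fib hy fun i j h ↦ by rw [hv _ _ (val_tbar_eq_of_val_eq h)]

/-- On a window `E ⊆ [−a, a]` the Gram form of any `v` against `w − avg w` vanishes. -/
theorem gram_sub_avg_eq_zero {a : ℝ} (hE : E ⊆ Icc (-a) a) (v w : truncIdx N → ℂ) :
    gram E N v (w - avg w) = 0 := by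
  rw [gram_eq_integral hE]
  simp [F_eq_zero_of_fib (fib_sum_sub_avg w)]

/-- For class-constant `v` the pairing against `w − avg w` vanishes. -/
theorem pairing_sub_avg_eq_zero {v : truncIdx N → ℂ} (hv : v ∈ classSub N) (w : truncIdx N → ℂ) :
    pairing N v (w - avg w) = 0 :=
  pairing_eq_zero_of_fib hv (fib_sum_sub_avg w)

/-- Steps A–B of §7 as a lemma: zero Gram cost on `[−a, a]` forces the exponential polynomial to vanish on `ℝ`. -/
theorem F_eq_zero_of_cost_nonpos {a : ℝ} (ha : 0 < a) {x : truncIdx N → ℂ}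
    (hle : ∫ u in Icc (-a) a, ‖F N x u‖ ^ 2 ≤ 0) : ∀ t : ℝ, F N x t = 0 := by
  set g : ℝ → ℝ := fun u ↦ ‖F N x u‖ ^ 2 with hg
  have hgc : Continuous g := by rw [hg]; exact ((continuous_F x).norm).pow 2
  have hgi : IntegrableOn g (Icc (-a) a) := hgc.integrableOn_Icc
  have hzero : ∀ u ∈ Ioo (-a) a, F N x u = 0 := by
    by_contra hne
    push Not at hne
    obtain ⟨u₀, hu₀, hF0⟩ := hne
    have hopen : IsOpen (Function.support g ∩ Ioo (-a) a) :=
      (isOpen_compl_singleton.preimage hgc).inter isOpen_Ioo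
    have hmem : u₀ ∈ Function.support g ∩ Ioo (-a) a :=
      ⟨by rw [Function.mem_support, hg]; positivity, hu₀⟩
    have hpos : 0 < volume (Function.support g ∩ Ioo (-a) a) := hopen.measure_pos volume ⟨u₀, hmem⟩
    have hpos' : 0 < (volume.restrict (Icc (-a) a)) (Function.support g) := by
      rw [Measure.restrict_apply' measurableSet_Icc]
      exact hpos.trans_le (measure_mono (Set.inter_subset_inter_right _ Ioo_subset_Icc_self))
    have hint : 0 < ∫ u in Icc (-a) a, g u :=
      (integral_pos_iff_support_of_nonneg_ae (Eventually.of_forall fun u ↦ by rw [hg]; positivity) hgi).2 hpos'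
    exact absurd hle (not_le.2 hint)
  set Fc : ℂ → ℂ := fun w ↦ ∑ j : truncIdx N, x j * cexp (-(I * (j : ZeroIdx).gamma * w)) with hFc
  have hdiff : Differentiable ℂ Fc := by rw [hFc]; fun_prop
  have han : AnalyticOnNhd ℂ Fc univ := Complex.analyticOnNhd_univ_iff_differentiable.2 hdiff
  have hfreq : ∃ᶠ z in 𝓝[≠] (0 : ℂ), Fc z = 0 := by
    rw [Filter.Frequently, eventually_nhdsWithin_iff, Metric.eventually_nhds_iff]
    rintro ⟨ε, hε, hall⟩
    set u : ℝ := min (ε / 2) (a / 2) with hu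
    have hu0 : 0 < u := lt_min (by linarith) (by linarith)
    have huε : u < ε := (min_le_left _ _).trans_lt (by linarith)
    have hua : u < a := (min_le_right _ _).trans_lt (by linarith)
    have h1 : dist (u : ℂ) 0 < ε := by
      rw [dist_zero_right, Complex.norm_real, Real.norm_of_nonneg hu0.le]; exact huε
    have h2 : (u : ℂ) ∈ ({0}ᶜ : Set ℂ) := by
      rw [Set.mem_compl_singleton_iff, Ne, Complex.ofReal_eq_zero]; exact hu0.ne'
    exact hall h1 h2 (hzero u ⟨by linarith, hua⟩)
  exact fun t ↦ han.eqOn_zero_of_preconnected_of_frequently_eq_zero isPreconnected_univ (Set.mem_univ 0) hfreq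
    (Set.mem_univ _)

/-- **Gram positivity on the class-constant subspace — no simplicity hypothesis.** [new] -/
theorem cost_pos_of_mem_classSub {a : ℝ} (ha : 0 < a) {x : truncIdx N → ℂ} (hxL : x ∈ classSub N)
    (hx : x ≠ 0) : 0 < ∫ u in Icc (-a) a, ‖F N x u‖ ^ 2 := by
  by_contra hle
  push Not at hle
  have hall := F_eq_zero_of_cost_nonpos ha hle
  obtain ⟨D, hD⟩ : ∃ D : Finset ℂ,
      D = (Finset.univ : Finset (truncIdx N)).image (fun j : truncIdx N ↦ (j : ZeroIdx).val) := ⟨_, rfl⟩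
  have hmemD : ∀ j : truncIdx N, (j : ZeroIdx).val ∈ D := fun j ↦ by
    rw [hD]; exact Finset.mem_image.2 ⟨j, Finset.mem_univ j, rfl⟩
  have hc : Function.Injective fun ρ : D ↦ -((ρ : ℂ) - 1 / 2) := by
    intro ρ ρ' h
    apply Subtype.ext
    have h' : -((ρ : ℂ) - 1 / 2) = -((ρ' : ℂ) - 1 / 2) := h
    linear_combination -h'
  -- regroup `F_x` over the distinct zeros
  have key : ∀ t : ℝ, ∑ ρ : D, (∑ j ∈ Finset.univ.filter (fun j : truncIdx N ↦ (j : ZeroIdx).val = ρ), x j) *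
      Complex.exp (-((ρ : ℂ) - 1 / 2) * t) = F N x t := by
    intro t
    have e := Finset.sum_coe_sort D (fun ρ : ℂ ↦ (∑ j ∈ Finset.univ.filter
      (fun j : truncIdx N ↦ (j : ZeroIdx).val = ρ), x j) * Complex.exp (-(ρ - 1 / 2) * t))
    beta_reduce at e
    rw [e]
    unfold F
    rw [← Finset.sum_fiberwise_of_maps_to (s := Finset.univ) (t := D) (g := fun j : truncIdx N ↦ (j : ZeroIdx).val)
      (fun j _ ↦ hmemD j)]
    refine Finset.sum_congr rfl fun ρ _ ↦ ?_
    rw [Finset.sum_mul]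
    refine Finset.sum_congr rfl fun j hj ↦ ?_
    have hjval : (j : ZeroIdx).val = ρ := by simpa [Finset.mem_filter] using hj
    rw [I_mul_gamma, hjval, neg_mul]
  have hsum : ∀ t : ℝ, ∑ ρ : D, (Polynomial.C (∑ j ∈ Finset.univ.filter
      (fun j : truncIdx N ↦ (j : ZeroIdx).val = ρ), x j)).eval (t : ℂ) * Complex.exp (-((ρ : ℂ) - 1 / 2) * t) = 0 := by
    intro t
    simp only [Polynomial.eval_C]
    rw [key t, hall t]
  apply hx
  funext j
  have hρ : (j : ZeroIdx).val ∈ D := hmemD j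
  have h1 := Literature.Analysis.ODE.ExpPolynomialsLinearIndependent.eq_zero_of_sum_eval_mul_exp_eq_zero' hc hsum
    ⟨_, hρ⟩
  rw [Polynomial.C_eq_zero] at h1
  have hfib : (Finset.univ.filter fun j' : truncIdx N ↦ (j' : ZeroIdx).val = (j : ZeroIdx).val) = fib j := rfl
  have h2 : ∑ j' ∈ fib j, x j' = (fib j).card * x j := by
    rw [Finset.sum_congr rfl fun j' hj' ↦ hxL j' j (mem_fib.1 hj'), Finset.sum_const, nsmul_eq_mul]
  have h3 : ((fib j).card : ℂ) * x j = 0 := by rw [← h2, ← hfib]; exact h1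
  exact (mul_eq_zero.1 h3).resolve_left (Nat.cast_ne_zero.2 (fib_card_pos j).ne')

end Summit.RiemannHypothesis.RiemannHypothesis.Theorems.Splittings.BombieriTruncMultiplicity
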